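import Summits.BirchSwinnertonDyer.BirchSwinnertonDyer.Theorems.ClassRecordThreeCornerAtThreeControlOfFacts
import Summits.BirchSwinnertonDyer.BirchSwinnertonDyer.Theorems.UniversalToricDescentTwinSigmaDataOfTorsion
import Summits.BirchSwinnertonDyer.BirchSwinnertonDyer.Theorems.ErratumRoadFiveJSWSigmaLocalCharIdeal
import Literature.NumberTheory.EllipticCurves.BigRepModuleShapiroDualityProofs
import Literature.NumberTheory.EllipticCurves.CanonicalPAdicHeightJunkSigmaProofs
import HarnessLib

/-!
# Route `UniversalToricDescent`, cruxes `TwinSplitIMCAtThreeMult` (stmt-BirchSwinnertonDyer-20694, bucket B) and ♭B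
# `TwinWanFrameAtThreeMult` (stmt-BirchSwinnertonDyer-26062), lines `threeframes` / `membertower`, research atom
# «`X^∅_ac(W′/K_∞)` is `Λ`-torsion» (the torsion half of stub `stub_sigmaDataMult`): it is PRINT — a theorem modulo four
# cited facts — on the sub-locus where the twin is itself a rank-one Kolyvagin curve over `K`
# (`ord_{s=1} L(W′,s) = 1`, `L(W′^{(d_K)},1) ≠ 0`), at EVERY slot above 3, with NO image and NO local-torsion hypothesis

Cell `bsd-wall` (run/shared/lean/pub/bsd-wall/), width seat `bsd-wall-utd-p2-w2` (prover g2, 2026-08-28);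
`--supports stmt-BirchSwinnertonDyer-20694 --as helper`.

## Context (numbers, not adjectives)

After the LEAD's reductions (p609362, p609906, p611180) and the discharges recorded in p612881, the ♭B line
`membertower` carries three research atoms: the Hida member tower, the residual cube locus, and the TORSION of
`X^∅_ac(W′/K_∞; slot 𝔭′)` for the 3-multiplicative twin `W′` under an all-split Heegner field `K` («Heegner side at
3 ∥ N′, not in print; for twins with `r_an(W′/K) = 1` it is control, JSW17 3.3.1» — skeleton v5 docstring). The tree
holds that control theorem AT EVERY ODD `p`, image-free and local-torsion-free:
`X11b.controlOnTreeAt_of_mult_of_rankOne_odd` (ClassRecordThree cell; Cas18 Thm. 2.3 / JSW17 Thm. 3.3.1 on the constructed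
`X_ac`, split case `CtlLoc.controlOnTreeAt_of_split_anyTorsion`, non-split case `X2.controlOnTreeAt_of_not_split_of_rankOne`),
CONDITIONAL on four cited facts BY NAME: GZK over `ℚ` (`rank_eq_analyticRank_of_analyticRank_le_one`), modularity
(`exists_isNewformOf`), Poitou–Tate for Selmer structures and for `Ш` (`poitouTate_selmerStructure_duality`,
`poitouTate_sha_tateDual` — the route's leaves `PoitouTateSelmerStructureDualityFact` / `PoitouTateShaTateDualFact`).
Its conclusion `ControlOnTreeAt` begins with `XAc.HasCharValuationAt … n`, whose first conjunct IS the torsion.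

* §1 `isTorsion_XAc_empty_of_mult_of_analyticRank_one_of_facts` — any `E/ℚ` globally minimal, odd `p` multiplicative,
  `ord_{s=1} L(E,s) = 1`, `K` imaginary quadratic with `p` split and `L(E^{(d_K)},1) ≠ 0`, anticyclotomic `(κ, γ)`,
  ANY prime `v ∋ p`: `X^∅_ac(E/K_∞; slot v)` is `Λ`-torsion. The non-torsion point the control theorem wants is
  PRODUCED here from GZK over `ℚ` (`rank E(ℚ) = 1`, `exists_not_isOfFinAddOrder_of_mordellWeilRank_ne_zero`, base-changed
  injectively to `K`), so no point is a binder.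
* §2 `twin_isTorsion_XAc_empty_of_rankOne_of_facts` — the same in the twin binders of `stub_sigmaDataMult` (`p = 3`,
  `Mult W′ 3`, conductor `N′`, `SatisfiesHeegnerHypothesis N′ K` ⟹ 3 split) plus the two (1,0)-locus binders
  `W′.analyticRank = 1`, `L(W′^{(d_K)},1) ≠ 0`.
* §3 `twin_sigmaDataMult_of_rankOne_of_facts` — composed with the LEAD's `twin_sigmaDataAt_of_isTorsion_empty`
  (p611180) whose two PUBLISHED binders are DISCHARGED by tree theorems (`prop323_XAc_equiv_XBigDecomp_holds`, K2 item
  20430; `sigmaLocal_charIdeal_eulerFactor_mem_of_noTamagawaDefect_proved`, K2 item 20495): on the (1,0)-locus the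
  registered stub `stub_sigmaDataMult` holds VERBATIM modulo the four cited facts; `twin_sigmaDataAt_of_isTorsion_empty'`
  — p611180 §3 with its two published binders discharged (torsion ⟹ Σ-data, NO named fact left).

HONEST FRAMING: theorems only (no definition, no named fact, no instance, no `sorry`); CONDITIONAL on the four cited
facts displayed as hypotheses; OFF the (1,0)-locus (twins with `r_an(W′/K) ≥ 3`, or `r_an(W′) = 0` with
`r_an(W′^{(d_K)}) = 1`) the torsion atom stays research; nothing is booked; BSD is proved for no curve; no census number
moves. The import of `ErratumRoadFiveJSWSigmaLocalCharIdeal` (the only tree home of the proved local fact) drags the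
`ErratumRoadFive` Theses cone (lint warning, accepted knowingly: re-proving (S5) Theses-free is ≈ 40 lines for a later pass).

References: [Castella2018] Thm. 2.3 (arXiv:1704.06608 p. 5); [JetchevSkinnerWan2017] Thm. 3.3.1, §3.5 (3.5.c), §5.1;
[SkinnerUrban2014] Prop. 3.2.3; [GrossZagier1986] Thm. I.6.3; [Kolyvagin1990] Thm. A; [MilneADT2006] I Thm. 4.10, 2.8.
-/

noncomputable section

open scoped Classical

set_option linter.dupNamespace false
set_option autoImplicit false

namespace Summit.BirchSwinnertonDyer.BirchSwinnertonDyer.Theorems.UniversalToricDescentTwinTorsionRankOne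

open WeierstrassCurve NumberField IsDedekindDomain Field
  Literature.NumberTheory.EllipticCurves Literature.NumberTheory.EllipticCurves.ModularForms
  Literature.NumberTheory.EllipticCurves.Rank1Residual Literature.NumberTheory.EllipticCurves.Castella2018
  Literature.NumberTheory.EllipticCurves.JetchevSkinnerWan2017 Literature.NumberTheory.GaloisCohomology
  Summit.BirchSwinnertonDyer.Rank1Residual Summit.BirchSwinnertonDyer.Rank1Residual.X11b
  Summit.BirchSwinnertonDyer.Rank1Residual.X11b.AcSelmer

/-! ### §1 Torsion of `X^∅_ac` at a multiplicative odd `p` for a rank-one Kolyvagin curve over `K`, any slot -/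

section AnyOddPrime

variable (W : WeierstrassCurve ℚ) [W.IsElliptic] [W.IsGloballyMinimal] (p : ℕ) [Fact p.Prime]
  {K : Type} [Field K] [NumberField K]

omit [W.IsGloballyMinimal] in
/-- **A rank-one curve over `ℚ` has a `K`-point of infinite order** (GZK over `ℚ`: `rank E(ℚ) = ord_{s=1} L(E,s) = 1`,
so some `P₀ ∈ E(ℚ)` has infinite order — `exists_not_isOfFinAddOrder_of_mordellWeilRank_ne_zero` — and base change
`E(ℚ) ↪ E(K)` is an injective homomorphism). CONDITIONAL on `hGZK`. [cite: GrossZagier1986, Thm. I.6.3]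
[cite: Kolyvagin1990, Thm. A] -/
theorem exists_not_isOfFinAddOrder_baseChange_of_analyticRank_one
    (hGZK : rank_eq_analyticRank_of_analyticRank_le_one) (hr : W.analyticRank = 1) :
    ∃ P : (W.baseChange K).toAffine.Point, ¬ IsOfFinAddOrder P := by
  have hrk : W.mordellWeilRank ≠ 0 := by
    rw [(hGZK W hr.le).1, hr]
    exact one_ne_zero
  obtain ⟨P₀, hP₀⟩ := W.exists_not_isOfFinAddOrder_of_mordellWeilRank_ne_zero hrk
  refine ⟨Affine.Point.map (W' := W) (F := ℚ) (Algebra.ofId ℚ K) P₀, fun h => hP₀ ?_⟩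
  exact ((Affine.Point.map_injective (W' := W) (F := ℚ) (Algebra.ofId ℚ K)).isOfFinAddOrder_iff
    (f := Affine.Point.map (W' := W) (F := ℚ) (Algebra.ofId ℚ K))).mp h

/-- **`X^∅_ac(E/K_∞; slot v)` IS `Λ`-TORSION for a rank-one Kolyvagin curve at a multiplicative odd `p`, ANY slot
`v ∋ p`** — `E/ℚ` globally minimal, `p` odd with `Mult E p`, `ord_{s=1} L(E,s) = 1`, `K` imaginary quadratic with `p`
split (`SplitsIn K p`) and `L(E^{(d_K)},1) ≠ 0`, `κ` anticyclotomic with generator `γ`: the first conjunct of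
`XAc.HasCharValuationAt` inside `X11b.controlOnTreeAt_of_mult_of_rankOne_odd` (Cas18 Thm. 2.3 / JSW17 Thm. 3.3.1 on the
constructed `X_ac`; image-free, local-torsion-free), at the degree-one prime `v` (`degreeOne_of_splitsIn`), with the
non-torsion point supplied by `exists_not_isOfFinAddOrder_baseChange_of_analyticRank_one`. CONDITIONAL on the four cited
facts `hGZK`, `hnf`, `hPT`, `hPT2`; nothing booked. [cite: Castella2018, Thm. 2.3 (arXiv:1704.06608 p. 5)]
[cite: JetchevSkinnerWan2017, Thm. 3.3.1 with §3.5 (3.5.c) (arXiv:1512.06894 pp. 11, 15)] -/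
theorem isTorsion_XAc_empty_of_mult_of_analyticRank_one_of_facts
    (hGZK : rank_eq_analyticRank_of_analyticRank_le_one) (hnf : exists_isNewformOf)
    (hPT : ∀ (K : Type) [Field K] [NumberField K], poitouTate_selmerStructure_duality K)
    (hPT2 : ∀ (K : Type) [Field K] [NumberField K], poitouTate_sha_tateDual K)
    (hp2 : p ≠ 2) (hmult : Mult W p) (hr : W.analyticRank = 1)
    (hK : IsImaginaryQuadratic K) (hsplit : SplitsIn K p)
    (hLt : (W.quadraticTwist (NumberField.discr K : ℚ)).entireLFunction 1 ≠ 0)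
    (κ : ZpExtension K p) (hκ : κ.IsAnticyclotomic) (γ : absoluteGaloisGroup K) [Fact (κ.IsTopGenerator γ)]
    (v : HeightOneSpectrum (𝓞 K)) (hv : ((p : ℕ) : 𝓞 K) ∈ v.asIdeal) :
    Module.IsTorsion (IwasawaAlgebra p) (XAc (W.baseChange K) p κ v ∅ γ) := by
  obtain ⟨P, hP⟩ := exists_not_isOfFinAddOrder_baseChange_of_analyticRank_one W (K := K) hGZK hr
  obtain ⟨he, hf⟩ := degreeOne_of_splitsIn hK.1 hsplit hv
  obtain ⟨n, hn, -⟩ := controlOnTreeAt_of_mult_of_rankOne_odd W p hGZK hnf hPT hPT2 hp2 hmult hr hK hsplit hLt P hP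
    κ hκ γ v hv he hf
  exact hn.1

end AnyOddPrime

/-! ### §2 The 3-multiplicative twin on the (1,0)-locus: the torsion atom of `stub_sigmaDataMult` -/

section Twin

variable (W' : WeierstrassCurve ℚ) [W'.IsElliptic] [W'.IsGloballyMinimal] (N' : ℕ)
  (K : Type) [Field K] [NumberField K]

/-- **TORSION OF `X^∅_ac(W′/K_∞; slot v)` ON THE (1,0)-LOCUS OF THE TWIN.** Under the binders of `stub_sigmaDataMult`
(`Mult W′ 3`, conductor `N′`, `K` imaginary quadratic with `SatisfiesHeegnerHypothesis N′ K` — so `3 ∣ N′` splits —,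
anticyclotomic `(κ, γ)`, any `v ∋ 3`, e.g. the X-slot `𝔭′`) PLUS `ord_{s=1} L(W′,s) = 1` and `L(W′^{(d_K)},1) ≠ 0`
(the twin is itself a rank-one Kolyvagin curve over `K`): `X^∅_ac(W′/K_∞; slot v)` is `Λ`-torsion, modulo the four
cited facts. The research content of the torsion atom is thereby confined to twins with `r_an(W′/K) ≠ 1` in this
configuration. [cite: Castella2018, Thm. 2.3 (arXiv:1704.06608 p. 5)] [cite: JetchevSkinnerWan2017, Thm. 3.3.1 (arXiv:1512.06894 p. 11)] -/
theorem twin_isTorsion_XAc_empty_of_rankOne_of_facts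
    (hGZK : rank_eq_analyticRank_of_analyticRank_le_one) (hnf : exists_isNewformOf)
    (hPT : ∀ (K : Type) [Field K] [NumberField K], poitouTate_selmerStructure_duality K)
    (hPT2 : ∀ (K : Type) [Field K] [NumberField K], poitouTate_sha_tateDual K)
    (hm : Mult W' 3) (hN : W'.conductorNorm ℤ = N') (hK : IsImaginaryQuadratic K)
    (hH : SatisfiesHeegnerHypothesis N' K)
    (hr : W'.analyticRank = 1) (hLt : (W'.quadraticTwist (NumberField.discr K : ℚ)).entireLFunction 1 ≠ 0)
    (κ : ZpExtension K 3) (hκ : κ.IsAnticyclotomic) (γ : absoluteGaloisGroup K) [Fact (κ.IsTopGenerator γ)]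
    (v : HeightOneSpectrum (𝓞 K)) (hv : ((3 : ℕ) : 𝓞 K) ∈ v.asIdeal) :
    Module.IsTorsion (IwasawaAlgebra 3) (XAc (W'.baseChange K) 3 κ v ∅ γ) := by
  have hsplit : SplitsIn K 3 := hH 3 Nat.prime_three (hN ▸ dvd_conductorNorm_of_mult hm)
  exact isTorsion_XAc_empty_of_mult_of_analyticRank_one_of_facts W' 3 hGZK hnf hPT hPT2 (by norm_num) hm hr hK hsplit
    hLt κ hκ γ v hv

end Twin

/-! ### §3 `stub_sigmaDataMult` on the (1,0)-locus, and p611180 §3 with its published binders discharged -/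

section SigmaData

variable (W' : WeierstrassCurve ℚ) [W'.IsElliptic] [W'.IsGloballyMinimal] (N' : ℕ)
  (K : Type) [Field K] [NumberField K]

/-- **p611180 §3 WITH ITS TWO PUBLISHED BINDERS DISCHARGED**: at the 3-multiplicative twin under an all-split Heegner
field, torsion of `X^∅_ac(W′/K_∞; slot 𝔭′)` ALONE gives the Road-FF `Σ`-data `P2.RoadFF.SigmaDataAt W′ 3 κ 𝔭' γ Σ P_Σ`
(the conclusion of `stub_sigmaDataMult` verbatim) — Shapiro [SU14 Prop. 3.2.3] is the tree theorem
`prop323_XAc_equiv_XBigDecomp_holds` (K2 item 20430) and the local `Σ`-display [JSW17 proof of Thm. 6.1.6] is the tree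
theorem `sigmaLocal_charIdeal_eulerFactor_mem_of_noTamagawaDefect_proved` (K2 item 20495). NO named fact left.
[cite: JetchevSkinnerWan2017, §5.1 and proof of Thm. 6.1.6] [cite: SkinnerUrban2014, Prop. 3.2.3]
[cite: Castella2018, Prop. 2.5 (no defect at places split in K)] -/
theorem twin_sigmaDataAt_of_isTorsion_empty'
    (hm : Mult W' 3) (hN : W'.conductorNorm ℤ = N') (hK : IsImaginaryQuadratic K)
    (hH : SatisfiesHeegnerHypothesis N' K)
    (κ : ZpExtension K 3) (hκ : κ.IsAnticyclotomic) (γ : absoluteGaloisGroup K) [Fact (κ.IsTopGenerator γ)]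
    (𝔭' : HeightOneSpectrum (𝓞 K)) (h𝔭' : ((3 : ℕ) : 𝓞 K) ∈ 𝔭'.asIdeal)
    (hT₀ : Module.IsTorsion (IwasawaAlgebra 3) (XAc (W'.baseChange K) 3 κ 𝔭' ∅ γ)) :
    P2.RoadFF.SigmaDataAt W' 3 κ 𝔭' γ (↑(W'.sigmaPlacesFinset 3 K) : Set (HeightOneSpectrum (𝓞 K)))
      (W'.sigmaEulerElement 3 K κ) :=
  twin_sigmaDataAt_of_isTorsion_empty sigmaLocal_charIdeal_eulerFactor_mem_of_noTamagawaDefect_proved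
    SkinnerUrban2014.prop323_XAc_equiv_XBigDecomp_holds W' N' K hm hN hK hH κ hκ γ 𝔭' h𝔭' hT₀

/-- **`stub_sigmaDataMult` ON THE (1,0)-LOCUS, modulo four cited facts**: under the stub's binders plus
`W′.analyticRank = 1` and `L(W′^{(d_K)},1) ≠ 0`, the Road-FF `Σ`-data at the X-slot `𝔭′` holds — §2 torsion fed to
`twin_sigmaDataAt_of_isTorsion_empty'`. CONDITIONAL on `hGZK`, `hnf`, `hPT`, `hPT2` (all cited, two of them route leaves);
nothing booked; BSD is proved for no curve. [cite: Castella2018, Thm. 2.3] [cite: JetchevSkinnerWan2017, Thm. 3.3.1 and §5.1]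
[cite: SkinnerUrban2014, Prop. 3.2.3] -/
theorem twin_sigmaDataMult_of_rankOne_of_facts
    (hGZK : rank_eq_analyticRank_of_analyticRank_le_one) (hnf : exists_isNewformOf)
    (hPT : ∀ (K : Type) [Field K] [NumberField K], poitouTate_selmerStructure_duality K)
    (hPT2 : ∀ (K : Type) [Field K] [NumberField K], poitouTate_sha_tateDual K)
    (hm : Mult W' 3) (hN : W'.conductorNorm ℤ = N') (hK : IsImaginaryQuadratic K)
    (hH : SatisfiesHeegnerHypothesis N' K)
    (hr : W'.analyticRank = 1) (hLt : (W'.quadraticTwist (NumberField.discr K : ℚ)).entireLFunction 1 ≠ 0)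
    (κ : ZpExtension K 3) (hκ : κ.IsAnticyclotomic) (γ : absoluteGaloisGroup K) [Fact (κ.IsTopGenerator γ)]
    (𝔭' : HeightOneSpectrum (𝓞 K)) (h𝔭' : ((3 : ℕ) : 𝓞 K) ∈ 𝔭'.asIdeal) :
    P2.RoadFF.SigmaDataAt W' 3 κ 𝔭' γ (↑(W'.sigmaPlacesFinset 3 K) : Set (HeightOneSpectrum (𝓞 K)))
      (W'.sigmaEulerElement 3 K κ) :=
  twin_sigmaDataAt_of_isTorsion_empty' W' N' K hm hN hK hH κ hκ γ 𝔭' h𝔭'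
    (twin_isTorsion_XAc_empty_of_rankOne_of_facts W' N' K hGZK hnf hPT hPT2 hm hN hK hH hr hLt κ hκ γ 𝔭' h𝔭')

end SigmaData

end Summit.BirchSwinnertonDyer.BirchSwinnertonDyer.Theorems.UniversalToricDescentTwinTorsionRankOne

end
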